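import Literature.Analysis.OperatorTheory.KernelIterateBridge
import Literature.Analysis.OperatorTheory.KernelPathIntegralPeeling
import HarnessLib

/-!
# Heterogeneous transfer-kernel path integrals as matrix elements of operator products

Helper file for item `stmt-AtomisticToContinuum-12398` (`SpecificHeatLimit`, route `HeatModeWeylLaw`
of `AtomisticToContinuum/FouriersLaw`). The transfer-operator computation of the variance of the
energy of the pinned anharmonic chain needs finite-volume Gibbs integrals with INSERTIONS (bond
observables at prescribed bonds), i.e. path integrals whose `i`-th bond carries its own bounded kernel
`K i`. This file generalises the tree's homogeneous peeling identities
(`Literature.Analysis.OperatorTheory.integral_pathWeight_succ_eq`,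
`…pow_kernelOp_toLp_ae_eq_iterate`) to an `ℕ`-indexed family of bounded measurable kernels on a finite
measure space `(Y, ρ)`:

* `integral_hetWeight_succ_eq` — one-step peeling (Fubini along `Fin.cons`);
* `hetPath_spec` — the path functional
  `u ↦ ∫ (∏_{i<n} K i ((u∷ζ)ᵢ, ζᵢ)) g((u∷ζ)_{last}) dρ^{⊗n}(ζ)` is bounded, strongly measurable and
  a.e. equal to `(Op 0 ∘ Op 1 ∘ ⋯ ∘ Op (n-1)) [g]` for the `L²` realisations `Op i` of the kernels;
* `integral_path_eq_inner_listProd` (**main**) —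
  `∫ f(ζ₀) (∏_{i<n} K i (ζᵢ, ζᵢ₊₁)) g(ζₙ) dρ^{⊗(n+1)}(ζ) = ⟪[f], ((List.range n).map Op).prod [g]⟫`;
* `listProd_map_range_of_eq` — bookkeeping for products of piecewise constant operator families.

All [folklore]; Mathlib + the two tree files only; no definitions.
-/

noncomputable section

open MeasureTheory Set Filter Function
open scoped RealInnerProductSpace ENNReal

namespace Summit.AtomisticToContinuum.FouriersLaw.Theorems.SpecificHeatLimit

open Literature.Analysis.OperatorTheory

variable {Y : Type*} [MeasurableSpace Y] {ρ : Measure Y} [IsFiniteMeasure ρ]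
  {K : ℕ → Y → Y → ℝ} {C : ℝ}

/-! ### Bookkeeping: measurability and bounds of heterogeneous path weights -/

/-- Joint measurability in `(u, ζ)` of the heterogeneous path weight
`∏_{i<M} K i ((u ∷ ζ)ᵢ, ζᵢ)`. [folklore] -/
theorem measurable_hetWeight (hK : ∀ i, Measurable (uncurry (K i))) (M : ℕ) :
    Measurable fun p : Y × (Fin M → Y) =>
      ∏ i : Fin M, K i ((Fin.cons p.1 p.2 : Fin (M + 1) → Y) (Fin.castSucc i)) (p.2 i) := by
  refine Finset.measurable_prod _ fun i _ => ?_
  have h1 : Measurable fun p : Y × (Fin M → Y) =>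
      (Fin.cons p.1 p.2 : Fin (M + 1) → Y) (Fin.castSucc i) :=
    (measurable_pi_apply _).comp (measurable_finCons M)
  have h2 : Measurable fun p : Y × (Fin M → Y) => p.2 i :=
    (measurable_pi_apply i).comp measurable_snd
  exact (hK i).comp (h1.prodMk h2)

omit [MeasurableSpace Y] in
/-- The heterogeneous path weight is bounded by `C^M` when every `|K i| ≤ C`. [folklore] -/
theorem norm_hetWeight_le (hC : ∀ i x y, ‖K i x y‖ ≤ C) (M : ℕ) (u : Y) (ζ : Fin M → Y) :
    ‖∏ i : Fin M, K i ((Fin.cons u ζ : Fin (M + 1) → Y) (Fin.castSucc i)) (ζ i)‖ ≤ C ^ M := by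
  have hC0 : 0 ≤ C := (norm_nonneg _).trans (hC 0 u u)
  calc ‖∏ i : Fin M, K i ((Fin.cons u ζ : Fin (M + 1) → Y) (Fin.castSucc i)) (ζ i)‖
      ≤ ∏ i : Fin M, ‖K i ((Fin.cons u ζ : Fin (M + 1) → Y) (Fin.castSucc i)) (ζ i)‖ :=
        Finset.norm_prod_le _ _
    _ ≤ ∏ _i : Fin M, C := Finset.prod_le_prod (fun i _ => norm_nonneg _) fun i _ => hC _ _ _
    _ = C ^ M := by simp

/-! ### One-step peeling -/

/-- **One-step peeling of a heterogeneous path weight.** For bounded measurable kernels `K i` on a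
finite measure space, a block of `M + 1` sites with left boundary spin `u` and a bounded measurable
`F`, `∫ (∏_{i≤M} K i ((u∷ζ)ᵢ, ζᵢ)) F(ζ) dρ^{⊗(M+1)}(ζ) =
∫ K 0 (u, y) [∫ (∏_{i<M} K (i+1) ((y∷ζ')ᵢ, ζ'ᵢ)) F(y∷ζ') dρ^{⊗M}(ζ')] dρ(y)`. [folklore] -/
theorem integral_hetWeight_succ_eq (hK : ∀ i, Measurable (uncurry (K i)))
    (hC : ∀ i x y, ‖K i x y‖ ≤ C) (M : ℕ) (u : Y) {F : (Fin (M + 1) → Y) → ℝ} (hF : Measurable F)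
    {B : ℝ} (hFb : ∀ ζ, ‖F ζ‖ ≤ B) :
    ∫ ζ : Fin (M + 1) → Y, (∏ i : Fin (M + 1),
        K i ((Fin.cons u ζ : Fin (M + 2) → Y) (Fin.castSucc i)) (ζ i)) * F ζ
        ∂(Measure.pi fun _ => ρ) =
      ∫ y, K 0 u y * ∫ ζ' : Fin M → Y, (∏ i : Fin M,
        K (i + 1) ((Fin.cons y ζ' : Fin (M + 1) → Y) (Fin.castSucc i)) (ζ' i)) *
          F (Fin.cons y ζ') ∂(Measure.pi fun _ => ρ) ∂ρ := by
  set pi : Measure (Fin M → Y) := Measure.pi fun _ => ρ with hpi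
  have hmp := (measurePreserving_piFinSuccAbove (fun _ : Fin (M + 1) => ρ) 0).symm
  set G : (Fin (M + 1) → Y) → ℝ := fun ζ =>
    (∏ i : Fin (M + 1), K i ((Fin.cons u ζ : Fin (M + 2) → Y) (Fin.castSucc i)) (ζ i)) * F ζ
    with hG
  have hcons : ∀ (y : Y) (ζ' : Fin M → Y),
      G (Fin.cons y ζ') = K 0 u y * ((∏ i : Fin M,
        K (i + 1) ((Fin.cons y ζ' : Fin (M + 1) → Y) (Fin.castSucc i)) (ζ' i)) *
          F (Fin.cons y ζ')) := by
    intro y ζ'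
    rw [hG]
    dsimp only
    rw [Fin.prod_univ_succ]
    simp only [Fin.cons_zero, Fin.cons_succ, Fin.castSucc_zero, ← Fin.succ_castSucc, Fin.val_zero,
      Fin.val_succ]
    ring
  have he : ∀ p : Y × (Fin M → Y),
      (MeasurableEquiv.piFinSuccAbove (fun _ : Fin (M + 1) => Y) 0).symm p = Fin.cons p.1 p.2 := by
    intro p
    simp only [MeasurableEquiv.piFinSuccAbove_symm_apply, Fin.insertNthEquiv, Fin.insertNth_zero,
      Equiv.coe_fn_mk]
    rfl
  have h1 : ∫ ζ, G ζ ∂(Measure.pi fun _ : Fin (M + 1) => ρ) =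
      ∫ p, G (Fin.cons p.1 p.2) ∂(ρ.prod pi) := by
    rw [← hmp.integral_comp']
    refine integral_congr_ae (Eventually.of_forall fun p => ?_)
    dsimp only
    rw [he]
  rw [h1]
  have hcm : Measurable fun p : Y × (Fin M → Y) => (Fin.cons p.1 p.2 : Fin (M + 1) → Y) :=
    measurable_finCons M
  have hGm : Measurable G := by
    have hw := measurable_hetWeight hK (M + 1)
    exact (hw.comp (measurable_const.prodMk measurable_id)).mul hF
  have hC0 : 0 ≤ C := (norm_nonneg _).trans (hC 0 u u)
  have hB0 : 0 ≤ B := (norm_nonneg _).trans (hFb (Fin.cons u fun _ => u))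
  have hGb : ∀ ζ, ‖G ζ‖ ≤ C ^ (M + 1) * B := fun ζ => by
    rw [hG]; dsimp only; rw [norm_mul]
    exact mul_le_mul (norm_hetWeight_le hC (M + 1) u ζ) (hFb ζ) (norm_nonneg _) (by positivity)
  have hint : Integrable (fun p : Y × (Fin M → Y) => G (Fin.cons p.1 p.2)) (ρ.prod pi) := by
    have hmeas : AEStronglyMeasurable (fun p : Y × (Fin M → Y) => G (Fin.cons p.1 p.2))
        (ρ.prod pi) := (hGm.comp hcm).aestronglyMeasurable
    exact memLp_one_iff_integrable.1
      (MemLp.of_bound hmeas (C ^ (M + 1) * B) (Eventually.of_forall fun p => hGb _))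
  rw [integral_prod _ hint]
  refine integral_congr_ae (Eventually.of_forall fun y => ?_)
  dsimp only
  simp_rw [hcons]
  rw [integral_const_mul]

/-! ### The path functional and its `L²` realisation -/

/-- **The heterogeneous path functional is bounded, strongly measurable, and a.e. equal to the
operator product applied to the observable.** For bounded measurable kernels `K i` (`i : ℕ`) on a
finite measure space with `L²` realisations `Op i` (`Op i ψ =ᵐ ∫ K i (·, y) ψ(y) dρ(y)`) and a bounded
measurable `g`, the functional
`u ↦ ∫ (∏_{i<n} K i ((u∷ζ)ᵢ, ζᵢ)) g((u∷ζ)_{last n}) dρ^{⊗n}(ζ)` (observable at the last site of the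
block, the left boundary spin `u` being site `0`) is bounded, strongly measurable, and a.e. equal to
`((List.range n).map Op).prod [g] = (Op 0 ∘ ⋯ ∘ Op (n-1)) [g]`. [folklore] -/
theorem hetPath_spec {g : Y → ℝ} (hg : Measurable g) {B : ℝ} (hgb : ∀ x, ‖g x‖ ≤ B) :
    ∀ (n : ℕ) (K : ℕ → Y → Y → ℝ) (Op : ℕ → (Lp ℝ 2 ρ →L[ℝ] Lp ℝ 2 ρ)),
      (∀ i, Measurable (uncurry (K i))) → (∀ i x y, ‖K i x y‖ ≤ C) →
      (∀ i (ψ : Lp ℝ 2 ρ), (Op i ψ : Y → ℝ) =ᵐ[ρ] fun x => ∫ y, K i x y * ψ y ∂ρ) →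
      (∃ B', ∀ u, ‖∫ ζ : Fin n → Y, (∏ i : Fin n,
          K i ((Fin.cons u ζ : Fin (n + 1) → Y) (Fin.castSucc i)) (ζ i)) *
          g ((Fin.cons u ζ : Fin (n + 1) → Y) (Fin.last n)) ∂(Measure.pi fun _ => ρ)‖ ≤ B') ∧
      StronglyMeasurable (fun u => ∫ ζ : Fin n → Y, (∏ i : Fin n,
          K i ((Fin.cons u ζ : Fin (n + 1) → Y) (Fin.castSucc i)) (ζ i)) *
          g ((Fin.cons u ζ : Fin (n + 1) → Y) (Fin.last n)) ∂(Measure.pi fun _ => ρ)) ∧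
      ((fun u => ∫ ζ : Fin n → Y, (∏ i : Fin n,
          K i ((Fin.cons u ζ : Fin (n + 1) → Y) (Fin.castSucc i)) (ζ i)) *
          g ((Fin.cons u ζ : Fin (n + 1) → Y) (Fin.last n)) ∂(Measure.pi fun _ => ρ)) =ᵐ[ρ]
        ((((List.range n).map Op).prod ((memLp_two_of_bound (μ := ρ) hg hgb).toLp g) : Lp ℝ 2 ρ) :
          Y → ℝ)) := by
  intro n
  induction n with
  | zero =>
    intro K Op hK hC hOp
    have h0 : ∀ u : Y, ∫ ζ : Fin 0 → Y, (∏ i : Fin 0,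
        K i ((Fin.cons u ζ : Fin (0 + 1) → Y) (Fin.castSucc i)) (ζ i)) *
        g ((Fin.cons u ζ : Fin (0 + 1) → Y) (Fin.last 0)) ∂(Measure.pi fun _ => ρ) = g u := by
      intro u
      simp only [Finset.univ_eq_empty, Finset.prod_empty, one_mul, Fin.last_zero, Fin.cons_zero]
      rw [integral_const, measureReal_def, Measure.pi_empty_univ, ENNReal.toReal_one, one_smul]
    simp_rw [h0]
    refine ⟨⟨B, hgb⟩, hg.stronglyMeasurable, ?_⟩
    simp only [List.range_zero, List.map_nil, List.prod_nil, one_apply_eq_self]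
    exact (memLp_two_of_bound (μ := ρ) hg hgb).coeFn_toLp.symm
  | succ n ih =>
    intro K Op hK hC hOp
    -- the shifted family
    obtain ⟨⟨B', hB'⟩, hsm, hae⟩ := ih (fun i => K (i + 1)) (fun i => Op (i + 1)) (fun i => hK (i + 1))
      (fun i => hC (i + 1)) (fun i => hOp (i + 1))
    set Pn : Y → ℝ := fun u => ∫ ζ : Fin n → Y, (∏ i : Fin n,
        K (i + 1) ((Fin.cons u ζ : Fin (n + 1) → Y) (Fin.castSucc i)) (ζ i)) *
        g ((Fin.cons u ζ : Fin (n + 1) → Y) (Fin.last n)) ∂(Measure.pi fun _ => ρ) with hPn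
    -- peeling the first site
    have hF : Measurable fun ζ : Fin (n + 1) → Y => g (ζ (Fin.last n)) :=
      hg.comp (measurable_pi_apply _)
    have hpeel : ∀ u : Y, ∫ ζ : Fin (n + 1) → Y, (∏ i : Fin (n + 1),
        K i ((Fin.cons u ζ : Fin (n + 1 + 1) → Y) (Fin.castSucc i)) (ζ i)) *
        g ((Fin.cons u ζ : Fin (n + 1 + 1) → Y) (Fin.last (n + 1))) ∂(Measure.pi fun _ => ρ) =
        ∫ y, K 0 u y * Pn y ∂ρ := by
      intro u
      have h1 := integral_hetWeight_succ_eq (ρ := ρ) hK hC n u hF (fun ζ => hgb _)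
      have e1 : ∀ ζ : Fin (n + 1) → Y,
          g ((Fin.cons u ζ : Fin (n + 1 + 1) → Y) (Fin.last (n + 1))) = g (ζ (Fin.last n)) := by
        intro ζ
        rw [← Fin.succ_last, Fin.cons_succ]
      simp_rw [e1]
      rw [h1]
    simp_rw [hpeel]
    refine ⟨⟨C * (B' * ρ.real univ), fun u => ?_⟩, ?_, ?_⟩
    · have hC0 : 0 ≤ C := (norm_nonneg _).trans (hC 0 u u)
      calc ‖∫ y, K 0 u y * Pn y ∂ρ‖ ≤ ∫ y, ‖K 0 u y * Pn y‖ ∂ρ := norm_integral_le_integral_norm _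
        _ ≤ ∫ _y, C * B' ∂ρ := by
            refine integral_mono_of_nonneg (Eventually.of_forall fun y => norm_nonneg _)
              (integrable_const _) (Eventually.of_forall fun y => ?_)
            dsimp only
            rw [norm_mul]
            exact mul_le_mul (hC 0 u y) (hB' y) (norm_nonneg _) hC0
        _ = C * (B' * ρ.real univ) := by rw [integral_const, smul_eq_mul]; ring
    · exact ((hK 0).stronglyMeasurable.mul (hsm.comp_measurable measurable_snd)).integral_prod_right'
    · -- replace `Pn` by the operator product a.e., then use the kernel formula for `Op 0`
      set G : Lp ℝ 2 ρ := ((List.range n).map fun i => Op (i + 1)).prod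
        ((memLp_two_of_bound (μ := ρ) hg hgb).toLp g) with hGdef
      have h2 : ∀ u, ∫ y, K 0 u y * Pn y ∂ρ = ∫ y, K 0 u y * G y ∂ρ := fun u =>
        integral_congr_ae (by filter_upwards [hae] with y hy; rw [hy])
      simp_rw [h2]
      rw [List.prod_range_succ', mul_apply_eq_comp]
      filter_upwards [hOp 0 G] with u hu
      rw [hu]

/-! ### The main identity -/

/-- **Heterogeneous path integrals are matrix elements of operator products.** For bounded
measurable kernels `K i` (`i : ℕ`) on a finite measure space `(Y, ρ)` with `L²` realisations `Op i`,
and bounded measurable `f, g`: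
`∫ f(ζ₀) (∏_{i<n} K i (ζᵢ, ζᵢ₊₁)) g(ζₙ) dρ^{⊗(n+1)}(ζ) = ⟪[f], ((List.range n).map Op).prod [g]⟫`,
i.e. `= ⟪[f], Op 0 (Op 1 (⋯ (Op (n-1) [g])))⟫` — the transfer-operator form of a finite-volume
Gibbs integral of a nearest-neighbour chain with bond-dependent Boltzmann factors / insertions.
[folklore] -/
theorem integral_path_eq_inner_listProd (hK : ∀ i, Measurable (uncurry (K i)))
    (hC : ∀ i x y, ‖K i x y‖ ≤ C) {Op : ℕ → (Lp ℝ 2 ρ →L[ℝ] Lp ℝ 2 ρ)}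
    (hOp : ∀ i (ψ : Lp ℝ 2 ρ), (Op i ψ : Y → ℝ) =ᵐ[ρ] fun x => ∫ y, K i x y * ψ y ∂ρ)
    {f g : Y → ℝ} (hf : Measurable f) {Bf : ℝ} (hfb : ∀ x, ‖f x‖ ≤ Bf)
    (hg : Measurable g) {Bg : ℝ} (hgb : ∀ x, ‖g x‖ ≤ Bg) (n : ℕ) :
    ∫ ζ : Fin (n + 1) → Y, f (ζ 0) * (∏ i : Fin n, K i (ζ (Fin.castSucc i)) (ζ i.succ)) *
        g (ζ (Fin.last n)) ∂(Measure.pi fun _ => ρ) =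
      ⟪(memLp_two_of_bound (μ := ρ) hf hfb).toLp f,
        ((List.range n).map Op).prod ((memLp_two_of_bound (μ := ρ) hg hgb).toLp g)⟫ := by
  obtain ⟨⟨B', hB'⟩, hsm, hae⟩ := hetPath_spec (ρ := ρ) (C := C) hg hgb n K Op hK hC hOp
  set pi : Measure (Fin n → Y) := Measure.pi fun _ => ρ with hpi
  set Pn : Y → ℝ := fun u => ∫ ζ : Fin n → Y, (∏ i : Fin n,
      K i ((Fin.cons u ζ : Fin (n + 1) → Y) (Fin.castSucc i)) (ζ i)) *
      g ((Fin.cons u ζ : Fin (n + 1) → Y) (Fin.last n)) ∂pi with hPn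
  -- Step 1: the left-hand side is `∫ f(u) Pn(u) dρ(u)` (Fubini along `Fin.cons`)
  have hmp := (measurePreserving_piFinSuccAbove (fun _ : Fin (n + 1) => ρ) 0).symm
  set G : (Fin (n + 1) → Y) → ℝ := fun ζ =>
    f (ζ 0) * (∏ i : Fin n, K i (ζ (Fin.castSucc i)) (ζ i.succ)) * g (ζ (Fin.last n)) with hG
  have hcons : ∀ (u : Y) (ζ : Fin n → Y), G (Fin.cons u ζ) =
      f u * ((∏ i : Fin n, K i ((Fin.cons u ζ : Fin (n + 1) → Y) (Fin.castSucc i)) (ζ i)) *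
        g ((Fin.cons u ζ : Fin (n + 1) → Y) (Fin.last n))) := by
    intro u ζ
    rw [hG]
    dsimp only
    simp only [Fin.cons_zero, Fin.cons_succ]
    ring
  have he : ∀ p : Y × (Fin n → Y),
      (MeasurableEquiv.piFinSuccAbove (fun _ : Fin (n + 1) => Y) 0).symm p = Fin.cons p.1 p.2 := by
    intro p
    simp only [MeasurableEquiv.piFinSuccAbove_symm_apply, Fin.insertNthEquiv, Fin.insertNth_zero,
      Equiv.coe_fn_mk]
    rfl
  have h1 : ∫ ζ, G ζ ∂(Measure.pi fun _ : Fin (n + 1) => ρ) =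
      ∫ p, G (Fin.cons p.1 p.2) ∂(ρ.prod pi) := by
    rw [← hmp.integral_comp']
    refine integral_congr_ae (Eventually.of_forall fun p => ?_)
    dsimp only
    rw [he]
  have hKi : ∀ i : Fin n, Measurable fun ζ : Fin (n + 1) → Y =>
      K i (ζ (Fin.castSucc i)) (ζ i.succ) := by
    intro i
    have h1 : Measurable fun ζ : Fin (n + 1) → Y => ζ (Fin.castSucc i) := measurable_pi_apply _
    have h2 : Measurable fun ζ : Fin (n + 1) → Y => ζ i.succ := measurable_pi_apply _
    exact (hK i).comp (h1.prodMk h2)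
  have hGm : Measurable G :=
    ((hf.comp (measurable_pi_apply 0)).mul (Finset.measurable_prod _ fun i _ => hKi i)).mul
      (hg.comp (measurable_pi_apply _))
  have hcm : Measurable fun p : Y × (Fin n → Y) => (Fin.cons p.1 p.2 : Fin (n + 1) → Y) :=
    measurable_finCons n
  have hGb : ∀ u ζ, ‖G (Fin.cons u ζ)‖ ≤ Bf * (C ^ n * Bg) := by
    intro u ζ
    have hC0 : 0 ≤ C := (norm_nonneg _).trans (hC 0 u u)
    have hBf0 : 0 ≤ Bf := (norm_nonneg _).trans (hfb u)
    rw [hcons, norm_mul, norm_mul]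
    refine mul_le_mul (hfb u) (mul_le_mul (norm_hetWeight_le hC n u ζ) (hgb _) (norm_nonneg _)
      (by positivity)) (by positivity) hBf0
  have hint : Integrable (fun p : Y × (Fin n → Y) => G (Fin.cons p.1 p.2)) (ρ.prod pi) := by
    have hmeas : AEStronglyMeasurable (fun p : Y × (Fin n → Y) => G (Fin.cons p.1 p.2))
        (ρ.prod pi) := (hGm.comp hcm).aestronglyMeasurable
    exact memLp_one_iff_integrable.1
      (MemLp.of_bound hmeas (Bf * (C ^ n * Bg)) (Eventually.of_forall fun p => hGb _ _))
  have h2 : ∫ ζ, G ζ ∂(Measure.pi fun _ : Fin (n + 1) => ρ) = ∫ u, f u * Pn u ∂ρ := by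
    rw [h1, integral_prod _ hint]
    refine integral_congr_ae (Eventually.of_forall fun u => ?_)
    dsimp only
    simp_rw [hcons]
    rw [integral_const_mul]
  change ∫ ζ, G ζ ∂(Measure.pi fun _ : Fin (n + 1) => ρ) = _
  rw [h2, inner_eq_integral]
  refine integral_congr_ae ?_
  filter_upwards [hae, (memLp_two_of_bound (μ := ρ) hf hfb).coeFn_toLp] with u hu hfu
  rw [hfu, ← hu]

/-! ### Products of piecewise constant operator families -/

/-- A run of equal factors: if `Op i = X` for `a ≤ i < a + k` then
`((List.range (a + k)).map Op).prod = ((List.range a).map Op).prod * X ^ k`. [folklore] -/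
theorem listProd_map_range_of_eq {M : Type*} [Monoid M] (Op : ℕ → M) (X : M) (a k : ℕ)
    (h : ∀ i, a ≤ i → i < a + k → Op i = X) :
    ((List.range (a + k)).map Op).prod = ((List.range a).map Op).prod * X ^ k := by
  induction k with
  | zero => simp
  | succ k ih =>
    rw [← add_assoc, List.prod_range_succ, ih fun i h1 h2 => h i h1 (by omega),
      h (a + k) (by omega) (by omega), mul_assoc, ← pow_succ]

end Summit.AtomisticToContinuum.FouriersLaw.Theorems.SpecificHeatLimit

end
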